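import Mathlib.NumberTheory.LSeries.Injectivity
import Literature.NumberTheory.LFunctions.ClassicalZeroFreeRegion
import Literature.NumberTheory.LFunctions.DedekindZetaVonMangoldt
import Literature.NumberTheory.LFunctions.PrimeIdealCountDegreeOne
import HarnessLib

/-!
# Bounds for `ζ_K(s)` on `σ > 1` that are uniform in the number field

Topic `Literature/NumberTheory/LFunctions` (namespace `Literature.NumberTheory.LFunctions.NumberField`,
next to `DedekindZetaVonMangoldt.lean`). Everything in this file is PROVED; there are no named facts.

For the Dedekind zeta function `ζ_K(s) = ∑ a_n n^{-s}` of a number field `K` of degree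
`n_K = [K : ℚ]` and its von Mangoldt weight `Λ_K` (`−ζ_K'/ζ_K = ∑ Λ_K(n) n^{-s}`,
`DedekindZetaVonMangoldt.lean`, `PrimeIdealPsi.lean`) we prove the elementary estimates that make
analytic arguments about `ζ_K` uniform in `K` (they enter Lagarias–Odlyzko, *Effective versions of
the Chebotarev density theorem* (1977), §5, and Landau 1903, §11):

* `vonMangoldtIdeal_le_finrank_mul_vonMangoldt` — **`Λ_K(n) ≤ [K : ℚ] Λ(n)`**: `Λ_K` is supported on
  prime powers `q^k`, where it collects `log N𝔭 = f_𝔭 log q` for some of the primes `𝔭 ∣ q`, and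
  `∑_{𝔭 ∣ q} f_𝔭 ≤ ∑_{𝔭 ∣ q} e_𝔭 f_𝔭 = [K : ℚ]` (Mathlib's `Ideal.sum_ramification_inertia`);
* `dedekindZeta_eq_exp_logSeries` — **`ζ_K(s) = exp(ℓ_K(s))`** on `σ > 1`, with
  `ℓ_K(s) = ∑_{n ≥ 2} Λ_K(n) n^{-s}/log n` (`ClassicalZFRData.logSeries`): the normalisation of
  `ClassicalZFRData.exists_eq_const_mul_exp_logSeries` with the constant pinned to `1` by letting
  `σ → +∞` (Mathlib's `LSeries.tendsto_atTop`);
* `exp_neg_le_norm_dedekindZeta`, `norm_dedekindZeta_le_exp` —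
  **`e^{−ℓ_K(σ)} ≤ |ζ_K(σ + it)| ≤ e^{ℓ_K(σ)}`** (`σ > 1`), the Euler-product bounds
  `ζ_K(2σ)/ζ_K(σ) ≤ |ζ_K(s)| ≤ ζ_K(σ)` in a weaker form that needs no product manipulations;
* `logSeries_re_le` — **`ℓ_K(σ) ≤ [K : ℚ]/(σ − 1)`** for real `σ > 1`
  (`Λ(n) ≤ log n` and `∑_{n ≥ 2} n^{-σ} ≤ ∫₁^∞ u^{-σ} du`);
* hence `norm_dedekindZeta_le_exp_finrank_div`, `exp_neg_finrank_div_le_norm_dedekindZeta`: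
  **`e^{−n_K/(σ−1)} ≤ |ζ_K(σ + it)| ≤ e^{n_K/(σ−1)}`** for `σ > 1`, uniformly in `K`.

These serve the GRH-conditional Chebyshev bound for prime ideals behind Bürgisser 2000 TCS,
Thm. 4.1 (`Literature/Computability/AlgebraicComplexity/BurgisserBooleanParts.lean`).

## References

* J. C. Lagarias, A. M. Odlyzko, *Effective versions of the Chebotarev density theorem*, in:
  Algebraic Number Fields (Durham 1975), Academic Press 1977, 409–464, §5 (`LagariasOdlyzko1977`).
* E. Landau, *Neuer Beweis des Primzahlsatzes und Beweis des Primidealsatzes*, Math. Ann. 56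
  (1903), 645–670, §11 (`LandauMathAnn1903`).
-/

noncomputable section

open Complex Filter Topology Finset
open scoped NumberField ComplexOrder

namespace Literature.NumberTheory.LFunctions.NumberField

variable (K : Type*) [Field K] [NumberField K]

/-! ### `Λ_K ≤ [K : ℚ] · Λ` -/

/-- `Λ_K(n) = 0` unless `n` is a prime power: a norm power `N𝔭^m`, `m ≥ 1`, is a prime power.
[folklore] -/
theorem vonMangoldtIdeal_eq_zero_of_not_isPrimePow {n : ℕ} (hn : ¬ IsPrimePow n) :
    vonMangoldtIdeal K n = 0 := by
  classical
  unfold vonMangoldtIdeal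
  refine sum_eq_zero fun P hP => ?_
  rw [mem_primeIdealsLE_toFinset] at hP
  rw [if_neg]
  intro hmem
  obtain ⟨m, hm, hmn⟩ := mem_image.mp hmem
  have hm1 : 1 ≤ m := (mem_Icc.mp hm).1
  have hpp : IsPrimePow (Ideal.absNorm P ^ m) := (isPrimePow_absNorm hP.1 hP.2.1).pow (by omega)
  rw [hmn] at hpp
  exact hn hpp

/-- **`Λ_K(n) ≤ [K : ℚ] · Λ(n)`** (Landau 1903, §11; Lagarias–Odlyzko 1977, §5): on a prime power
`n = q^k` the weight `Λ_K(n) = ∑_{N𝔭^m = n} log N𝔭` collects, for some primes `𝔭 ∣ q`, the value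
`log N𝔭 = f_𝔭 log q`, and `∑_{𝔭 ∣ q} f_𝔭 ≤ ∑_{𝔭 ∣ q} e_𝔭 f_𝔭 = [K : ℚ]`
(Mathlib's `Ideal.sum_ramification_inertia`); elsewhere both sides vanish.
[cite: LandauMathAnn1903, §11 p. 668] -/
theorem vonMangoldtIdeal_le_finrank_mul_vonMangoldt (n : ℕ) :
    vonMangoldtIdeal K n ≤ Module.finrank ℚ K * ArithmeticFunction.vonMangoldt n := by
  classical
  by_cases hn : IsPrimePow n
  swap
  · rw [vonMangoldtIdeal_eq_zero_of_not_isPrimePow K hn]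
    exact mul_nonneg (Nat.cast_nonneg _) ArithmeticFunction.vonMangoldt_nonneg
  obtain ⟨q, k, hq, hk, rfl⟩ := (isPrimePow_nat_iff n).mp hn
  rw [ArithmeticFunction.vonMangoldt_apply_pow hk.ne', ArithmeticFunction.vonMangoldt_apply_prime hq]
  haveI := Fact.mk hq
  haveI hmax : (Ideal.span {(q : ℤ)}).IsMaximal := Int.ideal_span_isMaximal_of_prime q
  have hq0 : Ideal.span {(q : ℤ)} ≠ ⊥ := by simp [hq.ne_zero]
  have hlogq : 0 ≤ Real.log q := Real.log_natCast_nonneg q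
  unfold vonMangoldtIdeal
  rw [← sum_filter]
  -- the contributing prime ideals lie over `q`
  have hsub : ((finite_primeIdealsLE K ((q ^ k : ℕ) : ℝ)).toFinset.filter fun P =>
      q ^ k ∈ (Icc 1 (q ^ k)).image (fun m => Ideal.absNorm P ^ m)) ⊆
        IsDedekindDomain.primesOverFinset (Ideal.span {(q : ℤ)}) (𝓞 K) := by
    intro P hP
    rw [mem_filter, mem_primeIdealsLE_toFinset] at hP
    obtain ⟨⟨hPp, -, -⟩, hmem⟩ := hP
    obtain ⟨m, hm, hmn⟩ := mem_image.mp hmem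
    have hm1 : 1 ≤ m := (mem_Icc.mp hm).1
    have hdvd : Ideal.absNorm P ∣ q ^ k :=
      ⟨Ideal.absNorm P ^ (m - 1), by rw [← pow_succ', Nat.sub_add_cancel hm1, hmn]⟩
    obtain ⟨j, -, hj⟩ := (Nat.dvd_prime_pow hq).1 hdvd
    rw [IsDedekindDomain.mem_primesOverFinset_iff hq0]
    exact mem_primesOver_of_absNorm_eq_pow hPp hq hj
  -- over `q`: `log N𝔭 = f_𝔭 log q` and `∑ f_𝔭 ≤ ∑ e_𝔭 f_𝔭 = [K : ℚ]`
  have hterm : ∀ P ∈ IsDedekindDomain.primesOverFinset (Ideal.span {(q : ℤ)}) (𝓞 K),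
      Real.log (Ideal.absNorm P) ≤
        ((Ideal.span {(q : ℤ)}).ramificationIdx' P * (Ideal.span {(q : ℤ)}).inertiaDeg' P : ℕ) *
          Real.log q := by
    intro P hP
    have hP' := (IsDedekindDomain.mem_primesOverFinset_iff hq0 _).mp hP
    haveI : P.IsPrime := hP'.1
    haveI : P.LiesOver (Ideal.span {(q : ℤ)}) := hP'.2
    rw [Ideal.absNorm_eq_pow_inertiaDeg' P hq, Nat.cast_pow, Real.log_pow]
    refine mul_le_mul_of_nonneg_right ?_ hlogq
    have he : 0 < (Ideal.span {(q : ℤ)}).ramificationIdx' P :=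
      Nat.pos_iff_ne_zero.mpr <| Ideal.IsDedekindDomain.ramificationIdx'_ne_zero_of_liesOver _ hq0
    exact_mod_cast Nat.le_mul_of_pos_left _ he
  calc ∑ P ∈ (finite_primeIdealsLE K ((q ^ k : ℕ) : ℝ)).toFinset.filter
          (fun P => q ^ k ∈ (Icc 1 (q ^ k)).image (fun m => Ideal.absNorm P ^ m)),
          Real.log (Ideal.absNorm P)
      ≤ ∑ P ∈ IsDedekindDomain.primesOverFinset (Ideal.span {(q : ℤ)}) (𝓞 K),
          Real.log (Ideal.absNorm P) :=
        sum_le_sum_of_subset_of_nonneg hsub fun P _ _ => Real.log_natCast_nonneg _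
    _ ≤ ∑ P ∈ IsDedekindDomain.primesOverFinset (Ideal.span {(q : ℤ)}) (𝓞 K),
          ((Ideal.span {(q : ℤ)}).ramificationIdx' P *
            (Ideal.span {(q : ℤ)}).inertiaDeg' P : ℕ) * Real.log q := sum_le_sum hterm
    _ = (Module.finrank ℚ K : ℕ) * Real.log q := by
        rw [← sum_mul, ← Nat.cast_sum, Ideal.sum_ramification_inertia (𝓞 K) ℚ K hq0]

/-- `Λ_K(n) ≤ [K : ℚ] log n` (from `Λ_K ≤ [K:ℚ] Λ` and `Λ ≤ log`). [folklore] -/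
theorem vonMangoldtIdeal_le_finrank_mul_log (n : ℕ) :
    vonMangoldtIdeal K n ≤ Module.finrank ℚ K * Real.log n :=
  (vonMangoldtIdeal_le_finrank_mul_vonMangoldt K n).trans
    (mul_le_mul_of_nonneg_left ArithmeticFunction.vonMangoldt_le_log (Nat.cast_nonneg _))

/-! ### `ζ_K = exp ℓ_K` on `σ > 1` -/

variable {K} in
/-- `1 < Re s` forces `s − 1 ≠ 0`. [folklore] -/
theorem sub_one_ne_zero_of_one_lt_re {s : ℂ} (hs : 1 < s.re) : s - 1 ≠ 0 := by
  intro h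
  have : s = 1 := sub_eq_zero.mp h
  rw [this, one_re] at hs
  exact lt_irrefl _ hs

/-- The hypothesis of `ClassicalZFRData.exists_eq_const_mul_exp_logSeries` for
`G(s) = (s − 1) ζ_K(s)` on `σ > 1`: `G'/G = 1/(s − 1) − ∑ Λ_K(n) n^{-s}`. [folklore] -/
theorem logDeriv_sub_one_mul_dedekindZeta {s : ℂ} (hs : 1 < s.re) :
    deriv (fun z => (z - 1) * NumberField.dedekindZeta K z) s /
        ((s - 1) * NumberField.dedekindZeta K s) =
      1 / (s - 1) - LSeries (fun n => (vonMangoldtIdeal K n : ℂ)) s := by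
  have hs1 := sub_one_ne_zero_of_one_lt_re hs
  have hζ := dedekindZeta_ne_zero_of_one_lt_re K hs
  have hd : HasDerivAt (fun z => (z - 1) * NumberField.dedekindZeta K z)
      (1 * NumberField.dedekindZeta K s + (s - 1) *
        -(NumberField.dedekindZeta K s * LSeries (fun n => (vonMangoldtIdeal K n : ℂ)) s)) s :=
    ((hasDerivAt_id' s).sub_const 1).mul (hasDerivAt_dedekindZeta K hs)
  rw [hd.deriv]
  field_simp
  ring

/-- **`ζ_K(s) = exp(ℓ_K(s))` for `σ > 1`**, `ℓ_K(s) = ∑_{n ≥ 2} Λ_K(n) n^{-s}/log n`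
(the logarithm of the Euler product, Landau 1903 §11; obtained here without products: the
function `(s−1)ζ_K(s) e^{−ℓ_K(s)}/(s−1)` is constant on the half-plane, and the constant is `1`
because `ζ_K(σ) → 1` and `ℓ_K(σ) → 0` as `σ → +∞`). [cite: LandauMathAnn1903, §11 p. 668] -/
theorem dedekindZeta_eq_exp_logSeries {s : ℂ} (hs : 1 < s.re) :
    NumberField.dedekindZeta K s =
      Complex.exp (ClassicalZFRData.logSeries (vonMangoldtIdeal K) s) := by
  have hΛ : ∀ n, 0 ≤ vonMangoldtIdeal K n := vonMangoldtIdeal_nonneg K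
  have h1 : vonMangoldtIdeal K 1 = 0 := vonMangoldtIdeal_one K
  have hsum : ∀ s : ℂ, 1 < s.re → LSeriesSummable (fun n ↦ (vonMangoldtIdeal K n : ℂ)) s :=
    fun s hs => LSeriesSummable_vonMangoldtIdeal K hs
  have hG : DifferentiableOn ℂ (fun z => (z - 1) * NumberField.dedekindZeta K z)
      {s : ℂ | 1 < s.re} :=
    ((differentiable_fun_id.sub_const 1).differentiableOn).mul
      (analyticOnNhd_dedekindZeta K).differentiableOn
  have hG0 : ∀ s : ℂ, 1 < s.re → (fun z => (z - 1) * NumberField.dedekindZeta K z) s ≠ 0 :=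
    fun s hs => mul_ne_zero (sub_one_ne_zero_of_one_lt_re hs)
      (dedekindZeta_ne_zero_of_one_lt_re K hs)
  obtain ⟨C, -, hC⟩ := ClassicalZFRData.exists_eq_const_mul_exp_logSeries hΛ h1 hsum hG hG0
    (fun s hs => logDeriv_sub_one_mul_dedekindZeta K hs)
  -- `ζ_K(s) = C exp(ℓ_K(s))` on `σ > 1`
  have hζ : ∀ s : ℂ, 1 < s.re → NumberField.dedekindZeta K s =
      C * Complex.exp (ClassicalZFRData.logSeries (vonMangoldtIdeal K) s) := by
    intro s hs
    have h := hC s hs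
    have h' : (s - 1) * NumberField.dedekindZeta K s =
        (s - 1) * (C * Complex.exp (ClassicalZFRData.logSeries (vonMangoldtIdeal K) s)) := by
      rw [h]; ring
    exact mul_left_cancel₀ (sub_one_ne_zero_of_one_lt_re hs) h'
  -- the constant is `1`: let `σ → +∞`
  have hlimζ : Tendsto (fun x : ℝ => NumberField.dedekindZeta K x) atTop (𝓝 1) := by
    have habs : LSeries.abscissaOfAbsConv (fun n => (idealNormCount K n : ℂ)) < ⊤ :=
      lt_of_le_of_lt (abscissaOfAbsConv_idealNormCount_le K) (EReal.coe_lt_top 1)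
    have h : Tendsto (fun x : ℝ => LSeries (fun n => (idealNormCount K n : ℂ)) x) atTop (𝓝 1) := by
      simpa [idealNormCount_one] using LSeries.tendsto_atTop habs
    exact h.congr fun x => (Literature.NumberTheory.LFunctions.dedekindZeta_eq_LSeries K x).symm
  have hlimℓ : Tendsto (fun x : ℝ =>
      Complex.exp (ClassicalZFRData.logSeries (vonMangoldtIdeal K) x)) atTop (𝓝 1) := by
    have habs : LSeries.abscissaOfAbsConv
        (fun n => ((vonMangoldtIdeal K n / Real.log n : ℝ) : ℂ)) < ⊤ :=
      lt_of_le_of_lt (ClassicalZFRData.abscissaOfAbsConv_div_log_le hΛ hsum) (EReal.coe_lt_top 1)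
    have h : Tendsto (fun x : ℝ => ClassicalZFRData.logSeries (vonMangoldtIdeal K) x)
        atTop (𝓝 0) := by
      simpa [ClassicalZFRData.logSeries] using LSeries.tendsto_atTop habs
    simpa [Function.comp_def] using (Complex.continuous_exp.tendsto 0).comp h
  have hev : ∀ᶠ x : ℝ in atTop, C * Complex.exp (ClassicalZFRData.logSeries (vonMangoldtIdeal K) x) =
      NumberField.dedekindZeta K x := by
    filter_upwards [eventually_gt_atTop 1] with x hx
    exact (hζ x (by simpa using hx)).symm
  have hlim2 : Tendsto (fun x : ℝ => NumberField.dedekindZeta K x) atTop (𝓝 (C * 1)) :=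
    (hlimℓ.const_mul C).congr' hev
  have hC1 : C = 1 := by
    have := tendsto_nhds_unique hlimζ hlim2
    rw [mul_one] at this
    exact this.symm
  rw [hζ s hs, hC1, one_mul]

/-- `|ζ_K(s)| = exp(Re ℓ_K(s))` for `σ > 1`. [folklore] -/
theorem norm_dedekindZeta_eq_exp_re {s : ℂ} (hs : 1 < s.re) :
    ‖NumberField.dedekindZeta K s‖ =
      Real.exp (ClassicalZFRData.logSeries (vonMangoldtIdeal K) s).re := by
  rw [dedekindZeta_eq_exp_logSeries K hs, Complex.norm_exp]

/-- **Lower bound `|ζ_K(σ + it)| ≥ e^{−ℓ_K(σ)}`** for `σ > 1` (`Re ℓ_K(σ+it) ≥ −ℓ_K(σ)` since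
`Λ_K ≥ 0`, `cos ≥ −1`; the product-free form of `|ζ_K(s)| ≥ ζ_K(2σ)/ζ_K(σ)`). [folklore] -/
theorem exp_neg_le_norm_dedekindZeta {s : ℂ} (hs : 1 < s.re) :
    Real.exp (-(ClassicalZFRData.logSeries (vonMangoldtIdeal K) (s.re : ℂ)).re) ≤
      ‖NumberField.dedekindZeta K s‖ := by
  rw [norm_dedekindZeta_eq_exp_re K hs, Real.exp_le_exp]
  exact ClassicalZFRData.neg_re_logSeries_le (vonMangoldtIdeal_nonneg K)
    (fun s hs => LSeriesSummable_vonMangoldtIdeal K hs) hs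

/-- **Upper bound `|ζ_K(σ + it)| ≤ e^{ℓ_K(σ)}`** for `σ > 1` (`|ℓ_K(s)| ≤ ℓ_K(σ)`; the product-free
form of `|ζ_K(s)| ≤ ζ_K(σ)`). [folklore] -/
theorem norm_dedekindZeta_le_exp {s : ℂ} (hs : 1 < s.re) :
    ‖NumberField.dedekindZeta K s‖ ≤
      Real.exp (ClassicalZFRData.logSeries (vonMangoldtIdeal K) (s.re : ℂ)).re := by
  rw [norm_dedekindZeta_eq_exp_re K hs, Real.exp_le_exp]
  have hb := ClassicalZFRData.norm_LSeries_le_re (Λ := fun n ↦ vonMangoldtIdeal K n / Real.log n)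
    (fun n ↦ div_nonneg (vonMangoldtIdeal_nonneg K n) (Real.log_natCast_nonneg n))
    (fun s hs ↦ ClassicalZFRData.LSeriesSummable_div_log (vonMangoldtIdeal_nonneg K)
      (fun s hs => LSeriesSummable_vonMangoldtIdeal K hs) hs) hs le_rfl
  exact (Complex.re_le_norm _).trans hb

/-! ### `ℓ_K(σ) ≤ [K : ℚ]/(σ − 1)` -/

/-- `∑_{2 ≤ n < N} n^{-σ} ≤ 1/(σ − 1)` for `σ > 1` (comparison with `∫₁^∞ u^{-σ} du`). [folklore] -/
theorem sum_Ico_rpow_neg_le {σ : ℝ} (hσ : 1 < σ) (N : ℕ) :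
    ∑ n ∈ Ico 2 N, (n : ℝ) ^ (-σ) ≤ 1 / (σ - 1) := by
  have hσ0 : 0 < σ - 1 := by linarith
  rcases le_or_gt N 2 with hN | hN
  · rw [Ico_eq_empty_of_le hN, sum_empty]; positivity
  obtain ⟨M, rfl⟩ : ∃ M, N = M + 1 := ⟨N - 1, by omega⟩
  have hM : 1 ≤ M := by omega
  rw [← Finset.sum_Ico_add' (fun n : ℕ => (n : ℝ) ^ (-σ)) 1 M 1]
  have hanti : AntitoneOn (fun u : ℝ => u ^ (-σ)) (Set.Icc ((1 : ℕ) : ℝ) ((M : ℕ) : ℝ)) := by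
    intro u hu v _ huv
    have hu1 : (0 : ℝ) < u := lt_of_lt_of_le (by simp) hu.1
    exact Real.rpow_le_rpow_of_nonpos hu1 huv (by linarith)
  refine (AntitoneOn.sum_le_integral_Ico hM hanti).trans ?_
  have h0 : (0 : ℝ) ∉ Set.uIcc ((1 : ℕ) : ℝ) ((M : ℕ) : ℝ) := by
    rw [Set.uIcc_of_le (by exact_mod_cast hM)]
    intro h
    have := h.1
    norm_num at this
  rw [integral_rpow (Or.inr ⟨by intro h; linarith, h0⟩), Nat.cast_one, Real.one_rpow]
  have hpow : 0 ≤ ((M : ℕ) : ℝ) ^ (-(σ - 1)) := Real.rpow_nonneg (Nat.cast_nonneg _) _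
  have hneg : -σ + 1 = -(σ - 1) := by ring
  rw [hneg, div_neg, ← neg_div, neg_sub]
  exact div_le_div_of_nonneg_right (by linarith) hσ0.le

/-- **`ℓ_K(σ) ≤ [K : ℚ]/(σ − 1)`** for real `σ > 1`: termwise `Λ_K(n)/log n ≤ [K : ℚ] Λ(n)/log n
≤ [K : ℚ]` for `n ≥ 2` (and `0` for `n ≤ 1`), and `∑_{n ≥ 2} n^{-σ} ≤ 1/(σ − 1)`. [folklore] -/
theorem logSeries_re_le {σ : ℝ} (hσ : 1 < σ) :
    (ClassicalZFRData.logSeries (vonMangoldtIdeal K) (σ : ℂ)).re ≤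
      Module.finrank ℚ K / (σ - 1) := by
  have hcle : ∀ n, vonMangoldtIdeal K n / Real.log n ≤ Module.finrank ℚ K := by
    intro n
    rcases eq_or_ne (Real.log n) 0 with h0 | h0
    · rw [h0, div_zero]; exact Nat.cast_nonneg _
    · rw [div_le_iff₀ (lt_of_le_of_ne (Real.log_natCast_nonneg n) (Ne.symm h0))]
      exact vonMangoldtIdeal_le_finrank_mul_log K n
  have hσ' : 1 < (σ : ℂ).re := by simp [hσ]
  rw [ClassicalZFRData.logSeries, LSeries]
  set f : ℕ → ℂ := fun n => ((vonMangoldtIdeal K n / Real.log n : ℝ) : ℂ) with hf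
  have hsum : LSeriesSummable f (σ : ℂ) :=
    ClassicalZFRData.LSeriesSummable_div_log (vonMangoldtIdeal_nonneg K)
      (fun s hs => LSeriesSummable_vonMangoldtIdeal K hs) hσ'
  -- the terms, as reals
  have hterm : ∀ n, (LSeries.term f (σ : ℂ) n).re =
      if n = 0 then 0 else vonMangoldtIdeal K n / Real.log n * (n : ℝ) ^ (-σ) := by
    intro n
    rcases eq_or_ne n 0 with rfl | hn
    · simp
    rw [LSeries.term_of_ne_zero hn, if_neg hn, hf]
    have hcpow : (n : ℂ) ^ (σ : ℂ) = ((n : ℝ) ^ σ : ℝ) := by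
      rw [Complex.ofReal_cpow (Nat.cast_nonneg n)]; simp
    simp only
    rw [hcpow, ← Complex.ofReal_div, Complex.ofReal_re, Real.rpow_neg (Nat.cast_nonneg n),
      div_eq_mul_inv]
  have hterm0 : ∀ n, 0 ≤ (LSeries.term f (σ : ℂ) n).re := by
    intro n
    rw [hterm]
    split_ifs
    · exact le_rfl
    · exact mul_nonneg (div_nonneg (vonMangoldtIdeal_nonneg K n) (Real.log_natCast_nonneg n))
        (Real.rpow_nonneg (Nat.cast_nonneg n) _)
  have htermle : ∀ n, (LSeries.term f (σ : ℂ) n).re ≤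
      if 2 ≤ n then (Module.finrank ℚ K : ℝ) * (n : ℝ) ^ (-σ) else 0 := by
    intro n
    rw [hterm]
    rcases lt_or_ge n 2 with hn | hn
    · rw [if_neg (not_le.mpr hn)]
      interval_cases n
      · simp
      · simp
    · rw [if_pos hn, if_neg (by omega)]
      exact mul_le_mul_of_nonneg_right (hcle n) (Real.rpow_nonneg (Nat.cast_nonneg n) _)
  rw [Complex.re_tsum hsum]
  refine Real.tsum_le_of_sum_range_le hterm0 fun N => ?_
  calc ∑ i ∈ range N, (LSeries.term f (σ : ℂ) i).re
      ≤ ∑ i ∈ range N, (if 2 ≤ i then (Module.finrank ℚ K : ℝ) * (i : ℝ) ^ (-σ) else 0) :=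
        sum_le_sum fun i _ => htermle i
    _ = Module.finrank ℚ K * ∑ i ∈ Ico 2 N, (i : ℝ) ^ (-σ) := by
        rw [← sum_filter, mul_sum]
        congr 1
        ext i
        simp only [mem_filter, mem_range, mem_Ico]
        omega
    _ ≤ Module.finrank ℚ K * (1 / (σ - 1)) :=
        mul_le_mul_of_nonneg_left (sum_Ico_rpow_neg_le hσ N) (Nat.cast_nonneg _)
    _ = Module.finrank ℚ K / (σ - 1) := by ring

/-- **`|ζ_K(σ + it)| ≤ e^{[K:ℚ]/(σ−1)}`** for `σ > 1`, uniformly in the number field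
(Lagarias–Odlyzko 1977, §5: `|ζ_K(s)| ≤ ζ_K(σ) ≤ ζ(σ)^{n_K}`). [cite: LagariasOdlyzko1977, §5] -/
theorem norm_dedekindZeta_le_exp_finrank_div {s : ℂ} (hs : 1 < s.re) :
    ‖NumberField.dedekindZeta K s‖ ≤ Real.exp (Module.finrank ℚ K / (s.re - 1)) :=
  (norm_dedekindZeta_le_exp K hs).trans (Real.exp_le_exp.2 (logSeries_re_le K hs))

/-- **`|ζ_K(σ + it)| ≥ e^{−[K:ℚ]/(σ−1)}`** for `σ > 1`, uniformly in the number field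
(Lagarias–Odlyzko 1977, §5: `|ζ_K(s)| ≥ ζ_K(2σ)/ζ_K(σ) ≥ ζ(σ)^{−n_K}`).
[cite: LagariasOdlyzko1977, §5] -/
theorem exp_neg_finrank_div_le_norm_dedekindZeta {s : ℂ} (hs : 1 < s.re) :
    Real.exp (-(Module.finrank ℚ K / (s.re - 1))) ≤ ‖NumberField.dedekindZeta K s‖ :=
  le_trans (Real.exp_le_exp.2 (neg_le_neg (logSeries_re_le K hs)))
    (exp_neg_le_norm_dedekindZeta K hs)

end Literature.NumberTheory.LFunctions.NumberField

end
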